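import Literature.Probability.LatticeModels.HighDimTrivialityMoments
import Literature.Probability.LatticeModels.SharpnessSubcritical
import HarnessLib

/-!
# High-dimensional triviality of Ising scaling limits, IV: uniformity in the temperature

Trunk: StatMech (G02); family `crit-ising` (crit-ising.S13). Fourth layer next to
`HighDimTriviality` / `HighDimTrivialityMoments` / `HighDimTrivialityWick`.

The statement `isGaussianProcess_of_tendstoInDistribution_smearedSpin` of `Sweep1`
(crit-ising.S13) quantifies over *arbitrary* sequences of temperatures `β_k ∈ [0, β_c]` and
meshes `δ_k → 0⁺`, whereas each printed estimate covers a regime: the critical windows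
`L ≤ ξ(β)` (Aizenman–Duminil-Copin 2021, Prop. 1.4, `d = 4`) and `L ≤ L(β)` (Panis 2023,
Cor. 1.8, `d = 4`, `L(β)` the sharp length), all `L ≥ 1` with a constant `C (β⁻⁴ ∨ β⁻²)`
(Panis 2023, Thm 5.5, `d ≥ 5`), and fixed `β < β_c` (white noise, by finite susceptibility and
Newman's central limit theorem: Panis 2023, §1.2.1, fn. 2; ADC 2021, §1.2, fn. 1).
`HighDimTriviality` therefore recorded the printed-regime form
`isGaussianProcess_of_tendstoInDistribution_smearedSpin_printRegime`. This file and its proof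
companion `HighDimTrivialityUniformProofs` close the gap: the quantity through which all the
printed proofs control the deviation from Gaussianity,
`S(μ; L, r) = Σ_L⁻² ∑_{x ∈ Λ_{rL}⁴} |U₄^μ(x)|` (`ursellFourSum`), tends to `0` as `L → ∞`
**uniformly in `β ∈ [0, β_c]`**, because outside the printed windows the *plain* tree diagram
bound of Aizenman (1982) already suffices once it is combined with the saturation of the
susceptibility at the sharp length (modified Simon–Lieb inequality of Duminil-Copin–Tassion,
proved in the tree) and the infrared bound (proved in the tree); see the module docstring of
`HighDimTrivialityUniformProofs` for the computation. That uniform smallness is a DERIVED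
statement (no source prints the uniformity in `β`): it is PROVED there as the explicit
conclusion of `ursellFourSum_uniformlySmall_of_facts` (for `d ≥ 4`, `r ≥ 1`, `ε > 0` there is
`L₀` with `S(μ; L, r) ≤ ε` for all `L ≥ L₀`, `β ∈ [0, β_c]`, `μ ∈ 𝒢(β, 0)`) and is given no
name of its own — the assembly takes it as an explicit hypothesis `hU` (an earlier version of
this file abbreviated it as a `Prop` named `ursellFourSum_uniformlySmall`; that abbreviation was
retired under D-0026 so that a derived statement is not counted as a named fact). The assembly
of crit-ising.S13 in its original (`Sweep1`) form from the uniform smallness is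
`HighDimTrivialityAssembly` (`isGaussianProcess_of_tendstoInDistribution_smearedSpin_of_facts`),
`HighDimTrivialityTreeBound` feeds the tree diagram bound from the finite-graph named fact of
the barrier catalogue (`…_of_treeDiagramBound`), and `HighDimTrivialityAssemblyProofs` reduces
the whole statement to the single named fact `panis_ursellFourSum_le_four`
(`isGaussianProcess_of_tendstoInDistribution_smearedSpin_of_panis_four`). All companions are in
the tree.

## Contents (this file: statements only)

* `aizenman_treeDiagramBound` — **named fact** (D-0014): Aizenman's tree diagram bound
  `|U₄^β(x₁,…,x₄)| ≤ 2 ∑_u ∏ᵢ ⟨σ_{xᵢ}σ_u⟩_β` in infinite volume (Aizenman, CMP 86 (1982); as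
  printed in Aizenman–Duminil-Copin 2021, §1.3, p. 6, display "(tree)", and Panis 2023, §1.2.1);
  it is the infinite-volume corollary of the tree's finite-graph named fact
  `Literature.Barriers.CriticalPhenomena.treeDiagramBound` (reduction for `d ≥ 3`:
  `HighDimTrivialityTreeBound.treeDiagramBound_dlr_of_treeDiagramBound`).
* `panis_ursellFourSum_le_four` — **named fact** (D-0014): the `d = 4` bound
  `S(μ; L, r) ≤ C r^γ (log L)^{-c}` in the sharp-length window `L ≤ L(β)` of Panis 2023,
  Cor. 1.8 (its proof, §6.6, bounds `S(β, L, f)`; the window is written through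
  Duminil-Copin–Tassion's `φ_β(S)`, `dctIsingPhi`, see the docstring).
* `tailSum S R = ∑_{‖x‖_∞ ≥ R} S(x)` — tail sums on `ℤ^d` (glue for the summed Simon–Lieb
  iteration of the proof file).

The uniform smallness itself is not declared here: it is the conclusion of
`ursellFourSum_uniformlySmall_of_facts` (`HighDimTrivialityUniformProofs`), proved from the two
facts above, `panis_ursellFourSum_le` (`d ≥ 5`, discharged in `HighDimTrivialityUrsellSum`) and
the structural facts on `𝒢(β, 0)` (all discharged), hence from `panis_ursellFourSum_le_four`
alone (`ursellFourSum_uniformlySmall_of_panis_four`, `HighDimTrivialityAssemblyProofs`).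

## Design choices

* As in `HighDimTriviality*`, facts are stated for every DLR state `μ ∈ 𝒢(β, 0) =
  isingGibbsMeasures d β 0` with `0 ≤ β ≤ β_c` (a singleton), two-point functions are written
  `∫ σ_x σ_u dμ`, and `U₄^μ = connectedFour μ spinAt`.
* The tree diagram bound is recorded with the series `∑_u ∏ᵢ ⟨σ_{xᵢ}σ_u⟩` as a real `tsum`
  under an explicit summability hypothesis (print: an unconditional inequality with a possibly
  infinite right-hand side, which implies this form; the series converges for `β < β_c` by
  sharpness and at `β_c` in `d ≥ 3` by the infrared bound).
* Panis's sharp length `L(β) = (2d)⁻¹ inf{k ≥ 1 : ∃ S ∋ 0, rad S ≤ 2k, φ_β(S) < 1/2}`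
  (Def. 3.21, with `φ_β(S) = β ∑_{x ∈ S, y ∉ S} J_{xy} ⟨σ₀σ_x⟩_{S,β}`) is not introduced as a
  number: the window hypothesis is unfolded as "every finite `S ∋ 0` inside `Λ_{16L}` has
  `φ_β(S) ≥ 1/2`" with the tree's `dctIsingPhi` (Duminil-Copin–Tassion's `φ`, with `tanh β` in
  place of Panis's `β`; since `tanh β ≤ β` and `rad S ≤ 2k < 16L` forces `S ⊆ Λ_{16L}`, this
  hypothesis implies `L ≤ L(β)`, so the fact below is implied by the printed one).

## Mathlib

Used: `tsum`/`Summable`, `Real.log`, `Real.rpow`. Mathlib has no Ising model / Ursell function.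
-/

noncomputable section

open MeasureTheory Filter Topology
open Literature.Probability.LatticeModels Literature.Probability.Percolation

namespace Literature.Probability.LatticeModels

/-! ### Aizenman's tree diagram bound -/

/-- **Aizenman's tree diagram bound, infinite volume** (Aizenman, *Geometric analysis of `φ⁴`
fields and Ising models*, Comm. Math. Phys. 86 (1982) 1–48 — proved there for the Ising model
on any finite graph at `h = 0`, `β ≥ 0`, the form held by the tree as the named fact
`Literature.Barriers.CriticalPhenomena.treeDiagramBound` (`IsingTrivialityFromDimensionFour`,
free boundary condition, after Aizenman, CDM 2020, Lemma 8.1 / (8.2)); recorded here in the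
infinite-volume form printed in Aizenman–Duminil-Copin, Ann. of Math. 194 (2021), §1.3, p. 6 of
arXiv:1912.07973, the display "(tree)": "… the tree diagram bound of [Aiz82]:
`|U₄^β(x,y,z,t)| ≤ 2 ∑_{u ∈ ℤ^d} ⟨σ_uσ_x⟩_β ⟨σ_uσ_y⟩_β ⟨σ_uσ_z⟩_β ⟨σ_uσ_t⟩_β`", and in Panis,
Ann. Probab. 54 (2026) = arXiv:2309.05797, §1.2.1, the display following "using the tree
diagram bound mentioned above"). **Relation to the tree.** This is the infinite-volume
corollary of `Literature.Barriers.CriticalPhenomena.treeDiagramBound` for the states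
`μ ∈ 𝒢(β, 0)`, `β ≤ β_c` (pass to the limit along boxes in the finite-graph inequality using
the box limits `hasBoxLimit_isingCorr_free`, volume monotonicity of the finite-volume two-point
functions and the uniqueness / free-state facts already used in `HighDimTrivialityMoments`,
Parts F–G); that reduction is `treeDiagramBound_dlr_of_treeDiagramBound` of
`HighDimTrivialityTreeBound` (for `d ≥ 3`, granting those structural facts), so a trust base
should list only the finite-graph fact (see
`isGaussianProcess_of_tendstoInDistribution_smearedSpin_of_treeDiagramBound` there); the two
names denote one printed theorem.
For the nearest-neighbour ferromagnetic Ising model on `ℤ^d`, `d ≥ 2`, `0 ≤ β ≤ β_c`, the DLR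
state `μ ∈ 𝒢(β, 0)` (a singleton) and sites `x₁, …, x₄`: whenever the series
`∑_u ∏ᵢ ⟨σ_{xᵢ}σ_u⟩_μ` converges, `|U₄^μ(x₁,…,x₄)| ≤ 2 ∑_u ∏ᵢ ⟨σ_{xᵢ}σ_u⟩_μ`, where
`U₄ = ⟨σ₁σ₂σ₃σ₄⟩ - ⟨σ₁σ₂⟩⟨σ₃σ₄⟩ - ⟨σ₁σ₃⟩⟨σ₂σ₄⟩ - ⟨σ₁σ₄⟩⟨σ₂σ₃⟩` (`connectedFour`). (Print states
the inequality with a possibly divergent right-hand side; the summability hypothesis makes the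
real `tsum` meaningful and weakens the statement.) Named fact (D-0014). [cite: AizenmanCMP1982, tree diagram bound (finite graphs, h = 0), via AizenmanCDM2020 Lemma 8.1 / (8.2)] [cite: AizenmanDuminilCopinAnnals2021, arXiv:1912.07973 §1.3, display (tree) (p. 6)] [cite: Panis2023Triviality, §1.2.1, tree diagram bound display] -/
def aizenman_treeDiagramBound : Prop :=
  ∀ {d : ℕ}, 2 ≤ d → ∀ β : ℝ, 0 ≤ β → β ≤ criticalBeta d →
    ∀ μ ∈ isingGibbsMeasures d β 0, ∀ x : Fin 4 → Site d,
      Summable (fun u : Site d => ∏ i, ∫ σ, spinAt (x i) σ * spinAt u σ ∂μ) →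
      |connectedFour μ spinAt x| ≤
        2 * ∑' u : Site d, ∏ i, ∫ σ, spinAt (x i) σ * spinAt u σ ∂μ

/-! ### Panis's `d = 4` bound in the sharp-length window -/

/-- **The sum of `|U₄|` over a box in the sharp-length window, `d = 4`** (Panis, *Triviality of
the scaling limits of critical Ising and `φ⁴` models with effective dimension at least four*,
Ann. Probab. 54 (2026) = arXiv:2309.05797, Corollary 1.8 — for the nearest-neighbour model,
which satisfies (A1)–(A6) of §1.2.1 — and its proof, §6.6, p. 33: "Applying the improved tree
diagram bound we obtain `S(β,L,f) ≤ C ∑ … /(B_{L(x₁,…,x₄)}(β)^c Σ_L(β)²)` …", the quantity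
`S(β, L, f) = Σ_L(β)⁻² ∑_{x₁,…,x₄ ∈ Λ_{r_f L}} |U₄^β(x₁,…,x₄)|` of the proof of Thm 5.5, p. 21,
being bounded there by `C r_f^γ (log L)^{-c}` for `1 ≤ L ≤ L(β)`, with constants independent of
`β ≤ β_c`; `L(β) = L^{(1/2)}(β)` is the sharp length of Def. 3.21,
`L^{(α)}(β) = (2d)⁻¹ inf{k ≥ 1 : ∃ S ∋ 0, rad(S) ≤ 2k, φ_β(S) < α}`,
`φ_β(S) = β ∑_{x ∈ S, y ∉ S} J_{x,y} ⟨σ₀σ_x⟩_{S,β}`, and `L(β_c) = ∞`, Remark 3.22).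
There exist `C, c, γ > 0` such that for every `0 ≤ β ≤ β_c(4)`, `L > 1`, `r ≥ 1` with
either `β = β_c` or the window property "`φ_β(S) ≥ 1/2` for every finite `S ∋ 0` with
`S ⊆ Λ_{16L}`" — written with Duminil-Copin–Tassion's `φ_β(S) = ∑ tanh(β) ⟨σ₀σ_x⟩_{S,β}`
(`dctIsingPhi`; as `tanh β ≤ β` it is at most Panis's `φ_β(S)`, and `rad S ≤ 2k`, `k < 8L`,
`0 ∈ S` give `S ⊆ Λ_{2k} ⊆ Λ_{16L}`, so the property implies `8L ≤ inf{…}`, i.e. `L ≤ L(β)`) —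
and the DLR state `μ ∈ 𝒢(β, 0)`:
`Σ_L⁻² ∑_{x₁,…,x₄ ∈ Λ_{rL}} |U₄(x₁,…,x₄)| ≤ C r^γ (log L)^{-c}` (`ursellFourSum μ L r`; as for
`aizenmanDuminilCopin_ursellFourSum_le`, `r_f ≤ 4r` for `f` vanishing outside `[-r,r]⁴` is
absorbed in `C`, and `(log L)^{-c}` presupposes `L > 1`). Named fact (D-0014). [cite: Panis2023Triviality, Cor. 1.8 and its proof §6.6 (p. 33), with Def. 3.21 and Rem. 3.22 (sharp length)] -/
def panis_ursellFourSum_le_four : Prop :=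
  ∃ C c γ : ℝ, 0 < C ∧ 0 < c ∧ 0 < γ ∧
    ∀ (β L r : ℝ), 0 ≤ β → β ≤ criticalBeta 4 → 1 < L → 1 ≤ r →
      (β = criticalBeta 4 ∨
        ∀ S : Finset (Site 4), (0 : Site 4) ∈ S → S ⊆ latticeBox 4 (16 * L) →
          1 / 2 ≤ dctIsingPhi 4 β S) →
    ∀ μ ∈ isingGibbsMeasures 4 β 0,
      ursellFourSum μ L r ≤ C * r ^ γ / Real.log L ^ c

/-! ### Tail sums on `ℤ^d` -/

/-- The tail sum `U_S(R) = ∑_{‖x‖_∞ ≥ R} S(x)` of a real function on `ℤ^d` beyond sup-norm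
radius `R` (a real `tsum`; junk `0` if the family is not summable). Used in
`HighDimTrivialityUniformProofs` to sum the modified Simon–Lieb inequality of
Duminil-Copin–Tassion over the tail (`U_S(R) ≤ φ_β(S₀) U_S(R - K - 1)` for `S₀ ⊆ Λ_K`).
[folklore] -/
def tailSum {d : ℕ} (S : Site d → ℝ) (R : ℕ) : ℝ :=
  ∑' x, if R ≤ Site.supNorm x then S x else 0

/-- Unfolding of `tailSum`. [folklore] -/
theorem tailSum_def {d : ℕ} (S : Site d → ℝ) (R : ℕ) :
    tailSum S R = ∑' x, if R ≤ Site.supNorm x then S x else 0 := rfl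

end Literature.Probability.LatticeModels
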